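import Summits.Ventures.PercRepro.S3SixWindow
import Summits.Ventures.PercRepro.RankLevelSetLevelSixGiant
import Summits.Ventures.PercRepro.RankLevelSetLevelSixGlueB
import Summits.Ventures.PercRepro.RankLevelSetCoreSixFiftyTwo
import Summits.Ventures.PercRepro.RankLevelSetLevelFiveMult

/-!
# PercRepro — S3, THE OPEN CELLS AFTER THE GIANT-FLAT CHAIN (p8, S3)

`proofs/SUBCLAIM-S3-p8.md` §1 / §3d, refreshed once more: the cell structure of `S3SixWindow` with the giant-flat
count — `c025_core_six_bounded_corank_giant` (coranks `7 … 50` closed from `p ≥ 175`, RankLevelSetLevelSixGiant),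
`c025_six_large_giant''` (`p ≥ 176` unconditional, RankLevelSetLevelSixGlueB) and `c025_core_six_fortythree_fiftytwo`
(corank `≥ 51` closed from `p ≥ 52`, RankLevelSetCoreSixFiftyTwo):
* **`rls_six_at_of_open_cells''`** — level `6` at `p₀ ≥ 9` ⇐ level `5` at `p₀ − 1` + the core cells `(p₀, 7 ≤ d ≤ 50)`
  when `p₀ < 175` + the cells `(p₀, d ≥ 51)` when `p₀ < 52`;
* **`s3Window_of_cells'''`** — S3 ⇐ the `(8, 6)` cell + level `5` at `8 ≤ p ≤ 174` (the S2 window below the split row)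
  + those open cells for `9 ≤ p₀ ≤ 174`; the rank `p = 175` needs level `5` at `174` only (every core cell at rank
  `175` is a tree theorem) and `p ≥ 176` is `c025_six_large_giant''`. So the window of record at `q = 6` is
  `8 ≤ p ≤ 175`, and its open content is: the `(8, 6)` cell, S2 on `8 … 174`, and the bounded-corank band
  `(p₀, 7 ≤ d ≤ 50)` for `9 ≤ p₀ ≤ 174` (plus `(p₀, d ≥ 51)` for `p₀ ≤ 51`).
Axioms: standard.
-/

open scoped Matroid

namespace PercRepro

namespace ThmN

variable {α : Type}

/-- **The open cells of S3 at rank `p₀`, after the giant-flat chain and the corank-`≥ 51` theorem from `52`.** -/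
theorem rls_six_at_of_open_cells'' (p₀ : ℕ) (hp : 9 ≤ p₀)
    (h5 : ∀ (M : Matroid α) [M.Finite], RLS M (p₀ - 1) 5)
    (hmid : ∀ (M : Matroid α) [M.Finite] (d : ℕ), 7 ≤ d → d ≤ 50 → p₀ < 175 →
      M.eRank = (p₀ : ℕ∞) → M.E.ncard = p₀ + d → EFree M → RLS M p₀ 6)
    (hbig : ∀ (M : Matroid α) [M.Finite] (d : ℕ), 51 ≤ d → p₀ < 52 →
      M.eRank = (p₀ : ℕ∞) → M.E.ncard = p₀ + d → EFree M → RLS M p₀ 6) :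
    ∀ (M : Matroid α) [M.Finite], RLS M p₀ 6 := by
  refine rls_six_at_of_core p₀ hp h5 ?_
  intro M _ d hd hR hn hfree
  rcases Nat.lt_or_ge d 51 with hd50 | hd51
  · rcases Nat.lt_or_ge p₀ 175 with hsmall | hlarge
    · exact hmid M d hd (by omega) hsmall hR hn hfree
    · exact c025_core_six_bounded_corank_giant M p₀ d hlarge hd (by omega) hR hn hfree
  · rcases Nat.lt_or_ge p₀ 52 with hsmall | hlarge
    · exact hbig M d hd51 hsmall hR hn hfree
    · exact c025_core_six_fortythree_fiftytwo M p₀ hlarge hR (by omega) hfree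

/-- **Rank `175` closes from level `5` at `174` alone**: every core cell at rank `175` is a tree theorem
(`c025_core_six_bounded_corank_giant` at coranks `7 … 50`, `c025_core_six_fortythree_fiftytwo` beyond), so C-025 at
level `6` holds at `p = 175` as soon as S2 holds at `p = 174` — and for every `p ≥ 176` unconditionally
(`c025_six_large_giant''`). -/
theorem c025_six_large_one_seventy_five
    (h5 : ∀ (M : Matroid α) [M.Finite], RLS M 174 5)
    (M : Matroid α) [M.Finite] (p : ℕ) (hp : 175 ≤ p) : RLS M p 6 := by
  rcases Nat.lt_or_ge p 176 with hlt | hge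
  · have h175 : p = 175 := by omega
    subst h175
    refine rls_six_at_of_core 175 (by norm_num) h5 ?_ M
    intro M _ d hd hR hn hfree
    rcases Nat.lt_or_ge d 51 with hd50 | hd51
    · exact c025_core_six_bounded_corank_giant M 175 d (by norm_num) hd (by omega) hR hn hfree
    · exact c025_core_six_fortythree_fiftytwo M 175 (by norm_num) hR (by omega) hfree
  · exact c025_six_large_giant'' M p hge

/-- **THEOREM C₆, the giant-flat count with p7's level-`5` row**: C-025 at level `6` for every `p ≥ 175`, every finite
matroid, unconditionally (`c025_five_large_mult` at `174` feeds `c025_six_large_one_seventy_five`). -/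
theorem c025_six_large_one_seventy_five' (M : Matroid α) [M.Finite] (p : ℕ) (hp : 175 ≤ p) : RLS M p 6 :=
  c025_six_large_one_seventy_five (fun M _ => c025_five_large_mult M 174 (by norm_num)) M p hp

/-- The same in the vocabulary of `C025`: the level-`6` frontier of the counting route is every `p ≥ 175`. -/
theorem c025_six_large_one_seventy_five'' (M : Matroid α) [M.Finite] (p : ℕ) (hp : 175 ≤ p) :
    phiK p 6 * ({A : Set α | A ⊆ M.E ∧ M.eRk A = (p : ℕ∞) ∧ M.eRk (M.E \ A) = (6 : ℕ∞)}.ncard : ℚ) ≤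
      ({A : Set α | A ⊆ M.E ∧ (6 : ℕ∞) < M.eRk A ∧ M.eRk A < (p : ℕ∞)}.ncard : ℚ) :=
  c025_six_large_one_seventy_five' M p hp

end ThmN

/-- **S3 from its open cells, after the giant-flat chain**: the `(8, 6)` cell, level `5` on the S2 window `8 ≤ p ≤ 174`,
and the open core cells of `rls_six_at_of_open_cells''` at every `9 ≤ p₀ ≤ 174`; `p = 175` closes from level `5` at
`174` and the core theorems alone, and `p ≥ 176` is `c025_six_large_giant''`. -/
theorem s3Window_of_cells'''
    (h86 : ∀ {α : Type} (M : Matroid α) [M.Finite], ThmN.RLS M 8 6)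
    (h5 : ∀ {α : Type} (M : Matroid α) [M.Finite] (p : ℕ), 8 ≤ p → p ≤ 174 → ThmN.RLS M p 5)
    (hmid : ∀ {α : Type} (M : Matroid α) [M.Finite] (p₀ d : ℕ), 9 ≤ p₀ → p₀ < 175 → 7 ≤ d → d ≤ 50 →
      M.eRank = (p₀ : ℕ∞) → M.E.ncard = p₀ + d → ThmN.EFree M → ThmN.RLS M p₀ 6)
    (hbig : ∀ {α : Type} (M : Matroid α) [M.Finite] (p₀ d : ℕ), 9 ≤ p₀ → p₀ < 52 → 51 ≤ d →
      M.eRank = (p₀ : ℕ∞) → M.E.ncard = p₀ + d → ThmN.EFree M → ThmN.RLS M p₀ 6) :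
    S3Window := by
  intro α M _ p hp8 hp
  rcases Nat.lt_or_ge p 9 with h8 | h9
  · have : p = 8 := by omega
    subst this
    exact h86 M
  · rcases Nat.lt_or_ge p 176 with hlt | hge
    · refine ThmN.rls_six_at_of_open_cells'' (α := α) p h9 ?_
        (fun M _ d hd hd50 hsm hR hn hf => hmid M p d h9 hsm hd hd50 hR hn hf)
        (fun M _ d hd51 hsm hR hn hf => hbig M p d h9 hsm hd51 hR hn hf) M
      intro M _
      exact h5 M (p - 1) (by omega) (by omega)
    · exact ThmN.c025_six_large_giant'' M p hge

/-- **The open content of S3, exactly**: the `(8, 6)` cell, level `5` on `8 ≤ p ≤ 82` (p7's `c025_five_large_mult`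
covers `p ≥ 83`), the bounded-corank band `(p₀, 7 ≤ d ≤ 50)` for `9 ≤ p₀ ≤ 174`, and `(p₀, d ≥ 51)` for `p₀ ≤ 51`;
everything else is a tree theorem. -/
theorem s3Window_of_cells''''
    (h86 : ∀ {α : Type} (M : Matroid α) [M.Finite], ThmN.RLS M 8 6)
    (h5 : ∀ {α : Type} (M : Matroid α) [M.Finite] (p : ℕ), 8 ≤ p → p ≤ 82 → ThmN.RLS M p 5)
    (hmid : ∀ {α : Type} (M : Matroid α) [M.Finite] (p₀ d : ℕ), 9 ≤ p₀ → p₀ < 175 → 7 ≤ d → d ≤ 50 →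
      M.eRank = (p₀ : ℕ∞) → M.E.ncard = p₀ + d → ThmN.EFree M → ThmN.RLS M p₀ 6)
    (hbig : ∀ {α : Type} (M : Matroid α) [M.Finite] (p₀ d : ℕ), 9 ≤ p₀ → p₀ < 52 → 51 ≤ d →
      M.eRank = (p₀ : ℕ∞) → M.E.ncard = p₀ + d → ThmN.EFree M → ThmN.RLS M p₀ 6) :
    S3Window := by
  refine s3Window_of_cells''' h86 ?_ hmid hbig
  intro α M _ p hp8 hp
  rcases Nat.lt_or_ge p 83 with hlt | hge
  · exact h5 M p hp8 (by omega)
  · exact ThmN.c025_five_large_mult M p hge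

end PercRepro
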